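import Mathlib.Analysis.InnerProductSpace.PiL2
import Mathlib.Analysis.Convex.Segment
import Mathlib.Algebra.Order.Floor.Ring
import Mathlib.Data.Fintype.Pi
import Mathlib.Data.Fin.VecNotation
import Literature.Probability.LatticeModels.ScalingLimit
import HarnessLib

/-!
# Plaquette discretisation of a flat round disc: the bonds of `ℤ^d` crossing it (`latticeDisc`)

Topic: Literature/Probability/LatticeModels (definition request `defn-latticeDisc`, wanted by the
route `LinkingParityCircles` of `Summits/CriticalPhenomena/Ising3DConformalLimit`, item
`stmt-CriticalPhenomena-4529`).

A disorder (Kadanoff–Ceva / Wegner) insertion along a closed loop `C = ∂S` of the dual lattice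
flips the couplings of the bonds of `ℤ^d` that pierce a spanning surface `S` (Kadanoff–Ceva 1971,
§II, in `ℤ²`; for the twist line defect of the 3D Ising model, Billó et al. 2013, §3). For a
ROUND disorder circle with centre `c`, radius `R` and (unit) normal `ν` the natural spanning
surface is the flat disc `D(c, R, ν) = {y ∈ ℝ^d | ⟪y - c, ν⟫ = 0, ‖y - c‖ < R}`; its plaquette
discretisation is the finite set of nearest-neighbour bonds `[a, a + eᵢ]` of `ℤ^d` crossing it.

Conventions (those of the request). A bond is an ordered pair `b = (a, i) : Site d × Fin d`,
standing for the segment from `a` to `a + eᵢ` (`eᵢ = Pi.single i 1`); lattice sites are embedded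
in `ℝ^d = EuclideanSpace ℝ (Fin d)` coordinatewise (`WithLp.toLp 2 fun j => (a j : ℝ)`, which is
`siteVec a` of `Sweep1.lean` and `siteToE a` of `QuantumLattice/LatticeScalarField.lean` by `rfl`;
neither is imported, to keep this file light). The bond *crosses the hyperplane* through `c` with
normal `ν` iff exactly one endpoint lies strictly below it — the half-open convention
`⟪a - c, ν⟫ < 0 ≤ ⟪a + eᵢ - c, ν⟫` or the reverse, i.e. `b` is in the edge boundary of the open
half-space `{⟪· - c, ν⟫ < 0}` — and then its crossing point `a + t eᵢ`,
`t = -⟪a - c, ν⟫ / νᵢ ∈ [0, 1]`, is required to lie within distance `R` of `c`.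

Main declarations:
* `siteHeight c ν a = ⟪a - c, ν⟫`, the signed height of a site above the hyperplane
  (`siteHeight_eq_sum`, `siteHeight_add_single`, `siteHeight_single`);
* `BondCrossesPlane c ν b` and `bondCrossingPoint c ν b` (`inner_bondCrossingPoint_sub`: the
  crossing point lies on the hyperplane; `bondCrossingPoint_mem_segment`: and on the bond);
* `latticeDisc c R ν : Finset (Site d × Fin d)` with `mem_latticeDisc`; finiteness comes from
  `abs_sub_lt_of_bondCrossesPlane` (every bond of the disc starts within sup-distance `R + 1`
  of `c`); `latticeDisc_smul` (only the direction of `ν` matters), `add_mem_latticeDisc_add_iff`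
  (covariance under lattice translations), `latticeDisc_mono`, `latticeDisc_eq_empty`;
* the axis-normal case in `ℤ³` used by the route: for `ν = e₂` (third axis) and `c = (0, 0, 1/2)`,
  `latticeDisc c R ν` is the set of vertical bonds `((p₁, p₂, 0), 2)` with `p₁² + p₂² < R²`
  (`mem_latticeDisc_axis_iff`, `latticeDisc_axis_eq_image`, `sum_latticeDisc_axis`), which is the
  finset inlined in `CardyDisorderCircle` / `DisorderCircleInversion` of route
  `LinkingParityCircles` (there with radius `R/δ`).

Mathlib anchors: `EuclideanSpace`, `EuclideanSpace.single`, `PiLp.norm_apply_le`,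
`PiLp.norm_single`, `EuclideanSpace.dist_eq`, `segment`, `Fintype.piFinset`, `Set.Finite.toFinset`.
Mathlib has no discretisation of surfaces by lattice bonds (searched `plaquette`, `latticeDisc`,
`dualSurface`; the tree's `DomainDiscretisation.lean` discretises planar DOMAINS, not
codimension-one surfaces).
-/

namespace Literature.Probability.LatticeModels

open Finset
open scoped RealInnerProductSpace

noncomputable section

variable {d : ℕ}

/-! ### Heights of sites above an affine hyperplane -/

/-- The signed height `⟪a - c, ν⟫` of the lattice site `a ∈ ℤ^d ⊆ ℝ^d` above the affine
hyperplane through `c` with normal vector `ν` (the signed distance when `‖ν‖ = 1`); the site is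
embedded coordinatewise. [folklore] -/
def siteHeight (c ν : EuclideanSpace ℝ (Fin d)) (a : Site d) : ℝ :=
  ⟪(WithLp.toLp 2 fun j => (a j : ℝ)) - c, ν⟫

/-- `siteHeight` in coordinates: `⟪a - c, ν⟫ = ∑ⱼ (aⱼ - cⱼ) νⱼ`. [folklore] -/
theorem siteHeight_eq_sum (c ν : EuclideanSpace ℝ (Fin d)) (a : Site d) :
    siteHeight c ν a = ∑ j, ((a j : ℝ) - c j) * ν j := by
  simp [siteHeight, PiLp.inner_apply, mul_comm]

/-- Moving the site by `eᵢ` raises its height by `νᵢ`: `⟪a + eᵢ - c, ν⟫ = ⟪a - c, ν⟫ + νᵢ`.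
[folklore] -/
theorem siteHeight_add_single (c ν : EuclideanSpace ℝ (Fin d)) (a : Site d) (i : Fin d) :
    siteHeight c ν (a + Pi.single i 1) = siteHeight c ν a + ν i := by
  rw [siteHeight_eq_sum, siteHeight_eq_sum]
  have h : ∀ j ∈ (univ : Finset (Fin d)),
      (((a + Pi.single i 1 : Site d) j : ℝ) - c j) * ν j =
        ((a j : ℝ) - c j) * ν j + if j = i then ν j else 0 := by
    intro j _
    rcases eq_or_ne j i with rfl | hj
    · simp; ring
    · simp [hj]
  rw [sum_congr rfl h, sum_add_distrib, sum_ite_eq' univ i, if_pos (mem_univ i)]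

/-- Height above a coordinate hyperplane: for the normal `ν = t • eᵢ`,
`⟪a - c, t eᵢ⟫ = t (aᵢ - cᵢ)`. [folklore] -/
theorem siteHeight_single (c : EuclideanSpace ℝ (Fin d)) (i : Fin d) (t : ℝ) (a : Site d) :
    siteHeight c (EuclideanSpace.single i t) a = t * ((a i : ℝ) - c i) := by
  simp [siteHeight, EuclideanSpace.inner_single_right]

/-- Scaling the normal scales the height: `⟪a - c, t ν⟫ = t ⟪a - c, ν⟫`. [folklore] -/
theorem siteHeight_smul (c ν : EuclideanSpace ℝ (Fin d)) (t : ℝ) (a : Site d) :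
    siteHeight c (t • ν) a = t * siteHeight c ν a := by
  simp [siteHeight, real_inner_smul_right]

/-- Translating the centre and the site by the same lattice vector does not change the height.
[folklore] -/
theorem siteHeight_add_left (c ν : EuclideanSpace ℝ (Fin d)) (v a : Site d) :
    siteHeight (c + WithLp.toLp 2 fun j => (v j : ℝ)) ν (a + v) = siteHeight c ν a := by
  rw [siteHeight_eq_sum, siteHeight_eq_sum]
  refine sum_congr rfl fun j _ => ?_
  simp only [Pi.add_apply, Int.cast_add, PiLp.add_apply]
  ring

/-! ### Bonds crossing a hyperplane -/

/-- The bond `b = (a, i)` of `ℤ^d`, i.e. the segment from `a` to `a + eᵢ`, *crosses* the affine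
hyperplane through `c` with normal `ν`: exactly one of its endpoints lies strictly below the
hyperplane — the half-open convention `⟪a - c, ν⟫ < 0 ≤ ⟪a + eᵢ - c, ν⟫` or
`⟪a + eᵢ - c, ν⟫ < 0 ≤ ⟪a - c, ν⟫` (so a hyperplane through lattice sites is crossed by the
bonds on one side only, and `b` crosses iff it lies in the edge boundary of the open half-space
`{x | ⟪x - c, ν⟫ < 0}`). [folklore] -/
def BondCrossesPlane (c ν : EuclideanSpace ℝ (Fin d)) (b : Site d × Fin d) : Prop :=
  (siteHeight c ν b.1 < 0 ∧ 0 ≤ siteHeight c ν (b.1 + Pi.single b.2 1)) ∨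
    (siteHeight c ν (b.1 + Pi.single b.2 1) < 0 ∧ 0 ≤ siteHeight c ν b.1)

/-- The point where the line through the bond `b = (a, i)` meets the hyperplane through `c` with
normal `ν`: `a + t eᵢ` with `t = -⟪a - c, ν⟫ / νᵢ` (junk value `a` when `νᵢ = 0`, i.e. when the
bond is parallel to the hyperplane, which never happens for a crossing bond,
`BondCrossesPlane.normal_ne_zero`). [folklore] -/
def bondCrossingPoint (c ν : EuclideanSpace ℝ (Fin d)) (b : Site d × Fin d) :
    EuclideanSpace ℝ (Fin d) :=
  (WithLp.toLp 2 fun j => (b.1 j : ℝ)) + (-siteHeight c ν b.1 / ν b.2) • EuclideanSpace.single b.2 1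

/-- Coordinates of the crossing point: `(a + t eᵢ)ⱼ = aⱼ + t [j = i]`. [folklore] -/
theorem bondCrossingPoint_apply (c ν : EuclideanSpace ℝ (Fin d)) (b : Site d × Fin d)
    (j : Fin d) :
    bondCrossingPoint c ν b j =
      (b.1 j : ℝ) + if j = b.2 then -siteHeight c ν b.1 / ν b.2 else 0 := by
  simp [bondCrossingPoint]

/-- A crossing bond is transversal to the hyperplane: `νᵢ ≠ 0`. [folklore] -/
theorem BondCrossesPlane.normal_ne_zero {c ν : EuclideanSpace ℝ (Fin d)} {b : Site d × Fin d}
    (h : BondCrossesPlane c ν b) : ν b.2 ≠ 0 := by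
  intro h0
  rcases h with ⟨h1, h2⟩ | ⟨h1, h2⟩ <;> rw [siteHeight_add_single, h0, add_zero] at * <;> linarith

/-- The crossing point lies on the hyperplane: `⟪(a + t eᵢ) - c, ν⟫ = 0` (whenever `νᵢ ≠ 0`).
[folklore] -/
theorem inner_bondCrossingPoint_sub {c ν : EuclideanSpace ℝ (Fin d)} {b : Site d × Fin d}
    (hν : ν b.2 ≠ 0) : ⟪bondCrossingPoint c ν b - c, ν⟫ = 0 := by
  rw [bondCrossingPoint, add_sub_right_comm, inner_add_left, inner_smul_left,
    EuclideanSpace.inner_single_left]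
  change siteHeight c ν b.1 + _ = 0
  simp only [map_one, one_mul, conj_trivial]
  field_simp
  ring

/-- For a crossing bond the crossing parameter `t = -⟪a - c, ν⟫ / νᵢ` lies in `[0, 1]`.
[folklore] -/
theorem BondCrossesPlane.param_mem_Icc {c ν : EuclideanSpace ℝ (Fin d)} {b : Site d × Fin d}
    (h : BondCrossesPlane c ν b) : -siteHeight c ν b.1 / ν b.2 ∈ Set.Icc (0 : ℝ) 1 := by
  rcases h with ⟨h1, h2⟩ | ⟨h1, h2⟩
  · rw [siteHeight_add_single] at h2
    have hν : 0 < ν b.2 := by linarith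
    exact ⟨div_nonneg (by linarith) hν.le, (div_le_one hν).2 (by linarith)⟩
  · rw [siteHeight_add_single] at h1
    have hν : ν b.2 < 0 := by linarith
    exact ⟨div_nonneg_of_nonpos (by linarith) hν.le, (div_le_one_of_neg hν).2 (by linarith)⟩

/-- The crossing point of a crossing bond lies on the bond: it belongs to the closed segment
`[a, a + eᵢ]` of `ℝ^d`. [folklore] -/
theorem bondCrossingPoint_mem_segment {c ν : EuclideanSpace ℝ (Fin d)} {b : Site d × Fin d}
    (h : BondCrossesPlane c ν b) :
    bondCrossingPoint c ν b ∈ segment ℝ (WithLp.toLp 2 fun j => (b.1 j : ℝ))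
      (WithLp.toLp 2 fun j => ((b.1 + Pi.single b.2 1 : Site d) j : ℝ)) := by
  obtain ⟨h0, h1⟩ := h.param_mem_Icc
  set t : ℝ := -siteHeight c ν b.1 / ν b.2 with ht
  have he : (WithLp.toLp 2 fun j => ((b.1 + Pi.single b.2 1 : Site d) j : ℝ) :
      EuclideanSpace ℝ (Fin d)) =
      (WithLp.toLp 2 fun j => (b.1 j : ℝ)) + EuclideanSpace.single b.2 (1 : ℝ) := by
    ext j
    rcases eq_or_ne j b.2 with rfl | hj
    · simp
    · simp [hj]
  refine ⟨1 - t, t, by linarith, h0, by ring, ?_⟩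
  rw [he, bondCrossingPoint, smul_add, ← add_assoc, ← add_smul, sub_add_cancel, one_smul]

/-- A crossing bond starts within distance `1` of its crossing point: `‖a - (a + t eᵢ)‖ = t ≤ 1`.
[folklore] -/
theorem BondCrossesPlane.dist_crossingPoint_le_one {c ν : EuclideanSpace ℝ (Fin d)}
    {b : Site d × Fin d} (h : BondCrossesPlane c ν b) :
    dist (WithLp.toLp 2 fun j => (b.1 j : ℝ) : EuclideanSpace ℝ (Fin d))
      (bondCrossingPoint c ν b) ≤ 1 := by
  obtain ⟨h0, h1⟩ := h.param_mem_Icc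
  rw [bondCrossingPoint, dist_eq_norm, sub_add_cancel_left, norm_neg, norm_smul,
    PiLp.norm_single, norm_one, mul_one, Real.norm_of_nonneg h0]
  exact h1

/-- Every bond `(a, i)` crossing the hyperplane within distance `R` of `c` starts in the open
sup-norm box of radius `R + 1` around `c`: `|aⱼ - cⱼ| < R + 1` for all `j`. This is the
finiteness estimate behind `latticeDisc`. [folklore] -/
theorem abs_sub_lt_of_bondCrossesPlane {c ν : EuclideanSpace ℝ (Fin d)} {R : ℝ}
    {b : Site d × Fin d} (h : BondCrossesPlane c ν b)
    (hR : dist (bondCrossingPoint c ν b) c < R) (j : Fin d) :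
    |(b.1 j : ℝ) - c j| < R + 1 := by
  set x : EuclideanSpace ℝ (Fin d) := WithLp.toLp 2 fun j => (b.1 j : ℝ) with hx
  have hxc : dist x c < R + 1 :=
    calc dist x c ≤ dist x (bondCrossingPoint c ν b) + dist (bondCrossingPoint c ν b) c :=
          dist_triangle _ _ _
      _ < 1 + R := add_lt_add_of_le_of_lt h.dist_crossingPoint_le_one hR
      _ = R + 1 := add_comm _ _
  calc |(b.1 j : ℝ) - c j| = ‖(x - c) j‖ := by simp [hx, Real.norm_eq_abs]
    _ ≤ ‖x - c‖ := PiLp.norm_apply_le (x - c) j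
    _ = dist x c := (dist_eq_norm x c).symm
    _ < R + 1 := hxc

/-- Rescaling the normal by `t > 0` does not change which bonds cross. [folklore] -/
theorem bondCrossesPlane_smul_iff (c ν : EuclideanSpace ℝ (Fin d)) {t : ℝ} (ht : 0 < t)
    (b : Site d × Fin d) : BondCrossesPlane c (t • ν) b ↔ BondCrossesPlane c ν b := by
  have key : ∀ s : ℝ, t * s < 0 ↔ s < 0 := fun s => by
    rw [← not_le, ← not_le, mul_nonneg_iff_of_pos_left ht]
  have key' : ∀ s : ℝ, 0 ≤ t * s ↔ 0 ≤ s := fun s => mul_nonneg_iff_of_pos_left ht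
  simp only [BondCrossesPlane, siteHeight_smul, key, key']

/-- Rescaling the normal by `t ≠ 0` does not move the crossing point. [folklore] -/
theorem bondCrossingPoint_smul (c ν : EuclideanSpace ℝ (Fin d)) {t : ℝ} (ht : t ≠ 0)
    (b : Site d × Fin d) : bondCrossingPoint c (t • ν) b = bondCrossingPoint c ν b := by
  simp only [bondCrossingPoint, siteHeight_smul, PiLp.smul_apply, smul_eq_mul]
  rw [← mul_neg, mul_div_mul_left _ _ ht]

/-- Translating the centre by a lattice vector `v` translates the crossing bonds by `v`.
[folklore] -/
theorem bondCrossesPlane_add_iff (c ν : EuclideanSpace ℝ (Fin d)) (v a : Site d) (i : Fin d) :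
    BondCrossesPlane (c + WithLp.toLp 2 fun j => (v j : ℝ)) ν (a + v, i) ↔
      BondCrossesPlane c ν (a, i) := by
  simp only [BondCrossesPlane, add_right_comm a v, siteHeight_add_left]

/-- Translating the centre by a lattice vector `v` translates the crossing points by `v`.
[folklore] -/
theorem bondCrossingPoint_add (c ν : EuclideanSpace ℝ (Fin d)) (v a : Site d) (i : Fin d) :
    bondCrossingPoint (c + WithLp.toLp 2 fun j => (v j : ℝ)) ν (a + v, i) =
      bondCrossingPoint c ν (a, i) + WithLp.toLp 2 fun j => (v j : ℝ) := by
  ext j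
  simp only [bondCrossingPoint_apply, siteHeight_add_left, Pi.add_apply, Int.cast_add,
    PiLp.add_apply]
  ring

/-! ### The lattice disc -/

/-- The set of bonds of `ℤ^d` crossing the hyperplane through `c` with normal `ν` at a point
within distance `R` of `c` is finite (it lies over the sup-norm box of radius `R + 1` around `c`).
[folklore] -/
theorem finite_setOf_bondCrossesPlane_dist_lt (c : EuclideanSpace ℝ (Fin d)) (R : ℝ)
    (ν : EuclideanSpace ℝ (Fin d)) :
    {b : Site d × Fin d |
      BondCrossesPlane c ν b ∧ dist (bondCrossingPoint c ν b) c < R}.Finite := by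
  refine (finite_toSet ((Fintype.piFinset fun j : Fin d =>
      Icc ⌈c j - (R + 1)⌉ ⌊c j + (R + 1)⌋) ×ˢ (univ : Finset (Fin d)))).subset ?_
  rintro ⟨a, i⟩ ⟨hcross, hdist⟩
  simp only [coe_product, coe_univ, Set.mem_prod, Set.mem_univ, and_true, mem_coe,
    Fintype.mem_piFinset, mem_Icc]
  intro j
  have hj := abs_lt.1 (abs_sub_lt_of_bondCrossesPlane hcross hdist j)
  constructor
  · exact Int.ceil_le.2 (by linarith [hj.1])
  · exact Int.le_floor.2 (by linarith [hj.2])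

/-- **The lattice disc** (plaquette discretisation of a flat round disc). For a centre
`c ∈ ℝ^d`, a radius `R` and a normal vector `ν`, `latticeDisc c R ν` is the finite set of bonds
`(a, i)` of `ℤ^d` — segments `[a, a + eᵢ]` — that cross the hyperplane `{y | ⟪y - c, ν⟫ = 0}` in
the half-open sense of `BondCrossesPlane` at a point within distance `R` of `c`, i.e. the bonds
meeting the flat disc `{y | ⟪y - c, ν⟫ = 0, ‖y - c‖ < R}`; flipping the couplings of these bonds
inserts a disorder operator on the round circle `∂D` (Kadanoff–Ceva construction). Only the
direction of `ν` matters, `R ≤ 0` gives `∅` (`latticeDisc_eq_empty`), and for `ν = e₂`,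
`c = (0, 0, 1/2)` in `ℤ³` this is the set of vertical bonds `((p₁, p₂, 0), 2)`, `p₁² + p₂² < R²`,
of route `LinkingParityCircles` (`latticeDisc_axis_eq_image`). [folklore] -/
def latticeDisc (c : EuclideanSpace ℝ (Fin d)) (R : ℝ) (ν : EuclideanSpace ℝ (Fin d)) :
    Finset (Site d × Fin d) :=
  (finite_setOf_bondCrossesPlane_dist_lt c R ν).toFinset

/-- Membership in the lattice disc: the bond crosses the hyperplane and its crossing point is
within distance `R` of the centre. [folklore] -/
@[simp] theorem mem_latticeDisc {c : EuclideanSpace ℝ (Fin d)} {R : ℝ}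
    {ν : EuclideanSpace ℝ (Fin d)} {b : Site d × Fin d} :
    b ∈ latticeDisc c R ν ↔ BondCrossesPlane c ν b ∧ dist (bondCrossingPoint c ν b) c < R := by
  simp [latticeDisc]

/-- The lattice disc as a set. [folklore] -/
theorem coe_latticeDisc (c : EuclideanSpace ℝ (Fin d)) (R : ℝ) (ν : EuclideanSpace ℝ (Fin d)) :
    (latticeDisc c R ν : Set (Site d × Fin d)) =
      {b | BondCrossesPlane c ν b ∧ dist (bondCrossingPoint c ν b) c < R} := by
  ext b
  simp

/-- A disc of non-positive radius contains no bond. [folklore] -/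
theorem latticeDisc_eq_empty (c : EuclideanSpace ℝ (Fin d)) {R : ℝ} (hR : R ≤ 0)
    (ν : EuclideanSpace ℝ (Fin d)) : latticeDisc c R ν = ∅ := by
  ext b
  simp only [mem_latticeDisc, notMem_empty, iff_false, not_and, not_lt]
  exact fun _ => hR.trans dist_nonneg

/-- The lattice disc is monotone in the radius. [folklore] -/
theorem latticeDisc_mono (c : EuclideanSpace ℝ (Fin d)) {R R' : ℝ} (h : R ≤ R')
    (ν : EuclideanSpace ℝ (Fin d)) : latticeDisc c R ν ⊆ latticeDisc c R' ν := by
  intro b hb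
  rw [mem_latticeDisc] at hb ⊢
  exact ⟨hb.1, hb.2.trans_le h⟩

/-- Every bond of the lattice disc starts in the sup-norm box of radius `R + 1` around the
centre. [folklore] -/
theorem abs_sub_lt_of_mem_latticeDisc {c : EuclideanSpace ℝ (Fin d)} {R : ℝ}
    {ν : EuclideanSpace ℝ (Fin d)} {b : Site d × Fin d} (hb : b ∈ latticeDisc c R ν) (j : Fin d) :
    |(b.1 j : ℝ) - c j| < R + 1 :=
  abs_sub_lt_of_bondCrossesPlane (mem_latticeDisc.1 hb).1 (mem_latticeDisc.1 hb).2 j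

/-- Only the direction of the normal matters: `latticeDisc c R (t • ν) = latticeDisc c R ν` for
`t > 0` (so `ν` may be normalised at will). [folklore] -/
theorem latticeDisc_smul (c : EuclideanSpace ℝ (Fin d)) (R : ℝ) (ν : EuclideanSpace ℝ (Fin d))
    {t : ℝ} (ht : 0 < t) : latticeDisc c R (t • ν) = latticeDisc c R ν := by
  ext b
  rw [mem_latticeDisc, mem_latticeDisc, bondCrossesPlane_smul_iff c ν ht,
    bondCrossingPoint_smul c ν ht.ne']

/-- Lattice translation covariance: the disc centred at `c + v`, `v ∈ ℤ^d`, consists of the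
translates `(a + v, i)` of the bonds `(a, i)` of the disc centred at `c`. [folklore] -/
theorem add_mem_latticeDisc_add_iff (c : EuclideanSpace ℝ (Fin d)) (R : ℝ)
    (ν : EuclideanSpace ℝ (Fin d)) (v a : Site d) (i : Fin d) :
    (a + v, i) ∈ latticeDisc (c + WithLp.toLp 2 fun j => (v j : ℝ)) R ν ↔
      (a, i) ∈ latticeDisc c R ν := by
  rw [mem_latticeDisc, mem_latticeDisc, bondCrossesPlane_add_iff, bondCrossingPoint_add,
    dist_add_right]

/-! ### The axis-normal disc of route `LinkingParityCircles` -/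

/-- **The horizontal disc of the route.** In `ℤ³`, for the normal `ν = e₂` (the third coordinate
axis) and the centre `c = (0, 0, 1/2)`, a bond `(a, i)` belongs to `latticeDisc c R e₂` iff it is
the vertical bond from `(a₀, a₁, 0)` to `(a₀, a₁, 1)` with `a₀² + a₁² < R²` (its crossing point is
`(a₀, a₁, 1/2)`). [folklore] -/
theorem mem_latticeDisc_axis_iff {R : ℝ} (hR : 0 ≤ R) (a : Site 3) (i : Fin 3) :
    (a, i) ∈ latticeDisc (EuclideanSpace.single 2 (1 / 2 : ℝ)) R (EuclideanSpace.single 2 1) ↔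
      i = 2 ∧ a 2 = 0 ∧ ((a 0 : ℝ)) ^ 2 + ((a 1 : ℝ)) ^ 2 < R ^ 2 := by
  rw [mem_latticeDisc, BondCrossesPlane, siteHeight_add_single, siteHeight_single]
  simp only [PiLp.single_apply, if_true, one_mul]
  by_cases hi : i = 2
  · subst hi
    simp only [if_true, true_and]
    have key : ((a 2 : ℝ) - 1 / 2 < 0 ∧ 0 ≤ (a 2 : ℝ) - 1 / 2 + 1 ∨
        (a 2 : ℝ) - 1 / 2 + 1 < 0 ∧ 0 ≤ (a 2 : ℝ) - 1 / 2) ↔ a 2 = 0 := by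
      constructor
      · rintro (⟨h1, h2⟩ | ⟨h1, h2⟩)
        · have h3 : (a 2 : ℝ) < 1 := by linarith
          have h4 : (-1 : ℝ) < a 2 := by linarith
          have h3' : a 2 < 1 := by exact_mod_cast h3
          have h4' : -1 < a 2 := by exact_mod_cast h4
          omega
        · exact absurd (h1.trans_le h2) (by linarith)
      · intro h
        left
        rw [h, Int.cast_zero]
        norm_num
    rw [key]
    refine and_congr_right fun h2 => ?_
    have hd : dist (bondCrossingPoint (EuclideanSpace.single 2 (1 / 2 : ℝ))
        (EuclideanSpace.single 2 1) (a, 2)) (EuclideanSpace.single 2 (1 / 2 : ℝ)) =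
        √(((a 0 : ℝ)) ^ 2 + ((a 1 : ℝ)) ^ 2) := by
      rw [EuclideanSpace.dist_eq, Fin.sum_univ_three]
      simp only [bondCrossingPoint_apply, siteHeight_single, PiLp.single_apply, Real.dist_eq,
        h2, Int.cast_zero]
      norm_num
    rw [hd, Real.sqrt_lt (by positivity) hR]
  · simp only [hi, if_false, add_zero, false_and, iff_false, not_and, not_lt]
    rintro (⟨h1, h2⟩ | ⟨h1, h2⟩) <;> exact absurd (h1.trans_le h2) (lt_irrefl _)

/-- The horizontal lattice disc of radius `R ≥ 0` centred at `(0, 0, 1/2)` is the image of the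
planar lattice points `p ∈ [-⌈R⌉, ⌈R⌉]²` with `p₁² + p₂² < R²` under `p ↦ ((p₁, p₂, 0), 2)` —
literally the finset inlined in `CardyDisorderCircle` / `DisorderCircleInversion` of route
`LinkingParityCircles` (with `R/δ` for `R`). [folklore] -/
theorem latticeDisc_axis_eq_image {R : ℝ} (hR : 0 ≤ R) :
    latticeDisc (EuclideanSpace.single 2 (1 / 2 : ℝ)) R (EuclideanSpace.single 2 1) =
      (((Icc (-⌈R⌉) ⌈R⌉) ×ˢ (Icc (-⌈R⌉) ⌈R⌉)).filter
          (fun p : ℤ × ℤ => ((p.1 : ℝ)) ^ 2 + ((p.2 : ℝ)) ^ 2 < R ^ 2)).image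
        fun p : ℤ × ℤ => ((![p.1, p.2, 0] : Site 3), (2 : Fin 3)) := by
  ext ⟨a, i⟩
  rw [mem_latticeDisc_axis_iff hR, mem_image]
  constructor
  · rintro ⟨rfl, ha2, hlt⟩
    have hsq : (⌈R⌉ : ℝ) ^ 2 ≥ R ^ 2 := by
      have := Int.le_ceil R
      nlinarith
    have hb : ∀ z : ℤ, ((z : ℝ)) ^ 2 < R ^ 2 → -⌈R⌉ ≤ z ∧ z ≤ ⌈R⌉ := by
      intro z hz
      have h1 : ((z : ℝ)) ^ 2 < (⌈R⌉ : ℝ) ^ 2 := hz.trans_le hsq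
      have h3 := abs_lt_of_sq_lt_sq' h1 (by exact_mod_cast Int.ceil_nonneg hR)
      exact ⟨by exact_mod_cast h3.1.le, by exact_mod_cast h3.2.le⟩
    refine ⟨(a 0, a 1), ?_, ?_⟩
    · simp only [mem_filter, mem_product, mem_Icc]
      exact ⟨⟨hb (a 0) (by nlinarith [sq_nonneg ((a 1 : ℝ))]),
        hb (a 1) (by nlinarith [sq_nonneg ((a 0 : ℝ))])⟩, hlt⟩
    · simp only [Prod.mk.injEq, and_true]
      ext j
      fin_cases j <;> simp [ha2]
  · rintro ⟨p, hp, hpa⟩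
    simp only [mem_filter, mem_product, mem_Icc] at hp
    simp only [Prod.mk.injEq] at hpa
    obtain ⟨rfl, rfl⟩ := hpa
    exact ⟨rfl, by simp, by simpa using hp.2⟩

/-- Sums over the horizontal lattice disc: for any bond functional `f (a, a + eᵢ)`,
`∑_{(a,i) ∈ latticeDisc} f a (a + eᵢ) = ∑_{p₁² + p₂² < R²} f (p₁, p₂, 0) (p₁, p₂, 1)`; with
`f x y = σ_x σ_y` this is the disorder-insertion sum `∑_{b ∈ D} σ_b` inlined in route
`LinkingParityCircles`. [folklore] -/
theorem sum_latticeDisc_axis {M : Type*} [AddCommMonoid M] {R : ℝ} (hR : 0 ≤ R)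
    (f : Site 3 → Site 3 → M) :
    ∑ b ∈ latticeDisc (EuclideanSpace.single 2 (1 / 2 : ℝ)) R (EuclideanSpace.single 2 1),
        f b.1 (b.1 + Pi.single b.2 1) =
      ∑ p ∈ ((Icc (-⌈R⌉) ⌈R⌉) ×ˢ (Icc (-⌈R⌉) ⌈R⌉)).filter
          (fun p : ℤ × ℤ => ((p.1 : ℝ)) ^ 2 + ((p.2 : ℝ)) ^ 2 < R ^ 2),
        f ![p.1, p.2, 0] ![p.1, p.2, 1] := by
  rw [latticeDisc_axis_eq_image hR, sum_image]
  · refine sum_congr rfl fun p _ => ?_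
    congr 1
    ext j
    fin_cases j <;> simp
  · intro p _ q _ h
    simp only [Prod.mk.injEq, and_true] at h
    have h0 := congr_fun h 0
    have h1 := congr_fun h 1
    simp only [Matrix.cons_val_zero, Matrix.cons_val_one] at h0 h1
    exact Prod.ext h0 h1

end

end Literature.Probability.LatticeModels
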